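/-
Copyright (c) 2026. All rights reserved.
Released under Apache 2.0 license as described in the file LICENSE.
Authors: abc-iut cell, campaign-S prover seat abc-iut-S8 (wave 2).
-/
import Literature.IUT.LogVolume.UnitLogVolume
import HarnessLib

/-!
# [IUTchIV] Prop. 1.4 (ii): discharge record

`UnitLogVolume.lean` types [IUTchIV] Prop. 1.4 (ii) (kurims p. 13) as the named statement `Prop14ii p K`
and proves it (`prop14ii_holds`).  This file only records the discharge under the tree's naming
convention `<Fact>_holds`, so that the statement is not carried as an unproved named fact.
Nothing here bears on the disputed [IUTchIII] Cor. 3.12.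
-/

noncomputable section

namespace Literature.IUT.LogVolume

variable (p : ℕ) [Fact p.Prime]
variable (K : Type*) [NontriviallyNormedField K] [NormedAlgebra ℚ_[p] K] [IsUltrametricDist K]
  [ProperSpace K] [MeasurableSpace K] [BorelSpace K]

/-- **[IUTchIV] Proposition 1.4 (ii) holds** (`μ^log(log_p(R^×)) = −(1/e + m/(ef))·log(p)`):
discharge of the named statement `Prop14ii`. [cite: Mochizuki2012, IUTchIV Prop. 1.4 (ii) p. 13] -/
theorem Prop14ii_holds : Prop14ii p K := prop14ii_holds p K

end Literature.IUT.LogVolume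

end
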